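import Literature.NumberTheory.LFunctions.ZetaArgVariation
import Literature.NumberTheory.LFunctions.ZetaOneLineBounds
import Literature.NumberTheory.LFunctions.DedekindZetaFiniteOrderProofs
import Mathlib.Analysis.Complex.PhragmenLindelof
import Mathlib.Analysis.SpecialFunctions.Gamma.Beta
import HarnessLib

/-!
# The shift inequality `|ξ(w − 1)| ≤ |ξ(w)|` for `Re w ≥ 1` (Lagarias–Suzuki 2006, Theorem 2.1)

Topic `Literature/NumberTheory/LFunctions` (trunk T-ANT), next to `RiemannXi.lean`
(`Literature.NumberTheory.LFunctions.riemannXi`, `ξ(s) = ½ s(s−1)π^{-s/2}Γ(s/2)ζ(s)`). Everything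
here is PROVED; there are no named facts.

J. C. Lagarias and M. Suzuki, *The Riemann hypothesis for certain integrals of Eisenstein series*,
J. Number Theory 118 (2006) 98–122, Theorem 2.1: if `F` is entire of genus `≤ 1`, real on the real
axis, `F(s) = ±F(1 − s)`, with all zeros in `|Re s − ½| < a`, then `|F(s + c)/F(s − c)| > 1` for
`Re s > ½` and every `c ≥ a`. Applied (proof of their Theorem 1.2, §2) to `F(s) = ξ(2s − ½)`,
`a = c = ¼`, it gives "`|ξ(2s)/ξ(2s − 1)| > 1` for `Re(s) > ½`", i.e.

  `|ξ(w − 1)| < |ξ(w)|` for `Re w > 1`, with equality `|ξ(w − 1)| = |ξ(w)|` on `Re w = 1`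

(on `Re w = 1`, `ξ(w − 1) = ξ(2 − w) = ξ(w̄) = conj ξ(w)`). This is the inequality behind the fact
that the constant term `ζ*(2s)y^s + ζ*(2 − 2s)y^{1−s}` of the Eisenstein series (equivalently
Lagarias–Suzuki's entire `H(y, s) = (s − 1)ξ(2s)y^s + s ξ(2s − 1)y^{1−s}`, §3) has, for `y ≥ 1`, all
its zeros on `Re s = ½` or on the real axis (their Theorem 1.3; Hejhal 1990), and it is the input
`|f(1 − s)| < |f(s)|` (`f(s) = k^s ζ*(2s)`, `σ > ½`) for Stark's theorem on the zeros of Epstein zeta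
functions (`Literature/Barriers/RiemannHypothesis/EpsteinZetaStark.lean`).

## Main results

* `Literature.NumberTheory.LFunctions.norm_riemannXi_sub_one_le` — **`‖ξ(w − 1)‖ ≤ ‖ξ(w)‖` for
  `1 ≤ Re w ≤ 10`** (the non-strict form, which is what the applications use; the range `Re w ≤ 10`
  covers `w = 2s`, `½ ≤ σ ≤ 5`).
* `Literature.NumberTheory.LFunctions.norm_completedRiemannZeta_shift_le` — the same in terms of
  Mathlib's `Λ = completedRiemannZeta`: `‖(s − 1) Λ(2s − 1)‖ ≤ ‖s Λ(2s)‖` for `½ < Re s ≤ 5`, `s ≠ 1`.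
* `Literature.NumberTheory.LFunctions.norm_betaIntegral_le` — `‖B(u, v)‖ ≤ B(Re u, Re v)` (the tool
  for the right edge).

## The proof given here (Phragmén–Lindelöf instead of the Hadamard product)

Lagarias–Suzuki prove Theorem 2.1 from the genus-one Hadamard factorisation of `F`, comparing the
distances from `s ± c` to each zero. Mathlib has no Hadamard factorisation of `ξ`, so we argue by the
maximum principle instead, for the quotient `q(w) = ξ(w − 1)/ξ(w)`, which is holomorphic on
`Re w ≥ 1` (`ξ ≠ 0` there, `Literature.NumberTheory.LFunctions.riemannXi_ne_zero_of_one_le_re`):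

* on `Re w = 1`: `|q| = 1` (functional equation and `ξ(w̄) = conj ξ(w)`);
* on `Re w = 10`: `q(w) = ((w − 2)/w) · B((w − 1)/2, ½) · ζ(w − 1)/ζ(w)` (`Γ(u)/Γ(u + ½) = B(u, ½)/√π`),
  and `|B(u, ½)| ≤ B(9/2, ½) = Γ(9/2)√π/Γ(5) = 105π/384 < 0.86`, `|ζ(9 + it)| ≤ 1.006`,
  `|ζ(10 + it)| ≥ 0.997` (`Literature.NumberTheory.LFunctions.norm_riemannZeta_sub_one_le_of_two_le_re`),
  so `|q| ≤ 0.87 < 1`;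
* inside the strip `q` grows at most like `exp(C |Im w|²)` (`Λ₀` is bounded on vertical strips,
  `Literature.NumberTheory.LFunctions.NumberField.weakFEPair_exists_norm_Λ₀_le`; `1/Γ` has Gaussian
  type on strips, `Literature.NumberTheory.LFunctions.NumberField.exists_norm_inv_Gamma_le_of_abs_re_le`;
  `1/|ζ| ≤ K log⁷|t|` up to `σ = 2`, `Literature.NumberTheory.LFunctions.ZetaOneLine.norm_riemannZeta_ge_inv_log_pow_seven`,
  and `|ζ| ≥ 0.34` beyond), which is far below the double-exponential allowance of the
  Phragmén–Lindelöf principle on a strip of width `9` (`PhragmenLindelof.vertical_strip`).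

Hence `|q| ≤ 1` throughout `1 ≤ Re w ≤ 10`.

## References

* [LagariasSuzuki2006] J. C. Lagarias, M. Suzuki, *The Riemann hypothesis for certain integrals of
  Eisenstein series*, J. Number Theory 118 (2006) 98–122, Theorem 2.1 and its application in the
  proof of Theorem 1.2 (§2); §3 (the function `H(y, s)`). (arXiv:math/0412039, read.)
* D. A. Hejhal, *On a result of G. Pólya concerning the Riemann `ξ`-function*, J. Analyse Math. 55
  (1990) 59–95 (the modified Riemann hypothesis for the constant term, cited by Lagarias–Suzuki).
* E. C. Titchmarsh, *The Theory of Functions*, 2nd ed., §5.65 (Phragmén–Lindelöf for a strip).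
-/

noncomputable section

open Complex Set Filter Topology Asymptotics MeasureTheory

open scoped Real ComplexConjugate Interval

namespace Literature.NumberTheory.LFunctions

/-! ### The Beta-integral bound `‖B(u, v)‖ ≤ B(Re u, Re v)` -/

/-- The real Beta integral in closed form: `∫₀¹ t^{a−1}(1 − t)^{b−1} dt = Γ(a)Γ(b)/Γ(a + b)`
(`a, b > 0`), from Mathlib's complex `Complex.Gamma_mul_Gamma_eq_betaIntegral`. [folklore] -/
theorem integral_rpow_mul_one_sub_rpow {a b : ℝ} (ha : 0 < a) (hb : 0 < b) :
    ∫ t in (0 : ℝ)..1, t ^ (a - 1) * (1 - t) ^ (b - 1) =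
      Real.Gamma a * Real.Gamma b / Real.Gamma (a + b) := by
  have hab : 0 < a + b := by linarith
  have hG : Complex.Gamma ((a : ℂ) + b) ≠ 0 := by
    rw [show ((a : ℂ) + b) = ((a + b : ℝ) : ℂ) by push_cast; ring, Complex.Gamma_ofReal]
    exact_mod_cast (Real.Gamma_pos_of_pos hab).ne'
  have hB : Complex.betaIntegral a b =
      ((Real.Gamma a * Real.Gamma b / Real.Gamma (a + b) : ℝ) : ℂ) := by
    have h := Complex.Gamma_mul_Gamma_eq_betaIntegral (s := a) (t := b) (by simpa using ha)
      (by simpa using hb)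
    rw [show ((a : ℂ) + b) = ((a + b : ℝ) : ℂ) by push_cast; ring] at h hG
    rw [Complex.Gamma_ofReal, Complex.Gamma_ofReal, Complex.Gamma_ofReal] at h
    rw [Complex.Gamma_ofReal] at hG
    push_cast
    field_simp
    linear_combination -h
  have hI : Complex.betaIntegral a b =
      ((∫ t in (0 : ℝ)..1, t ^ (a - 1) * (1 - t) ^ (b - 1) : ℝ) : ℂ) := by
    rw [Complex.betaIntegral, ← intervalIntegral.integral_ofReal]
    refine intervalIntegral.integral_congr_ae ?_
    have h1 : ∀ᵐ t : ℝ, t ≠ 1 := by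
      rw [ae_iff]
      simp
    filter_upwards [h1] with t ht1 ht
    rw [uIoc_of_le zero_le_one] at ht
    have ht0 : 0 ≤ t := ht.1.le
    have ht1' : 0 ≤ 1 - t := by linarith [ht.2]
    push_cast
    rw [Complex.ofReal_cpow ht0, Complex.ofReal_cpow ht1']
    push_cast
    ring_nf
  have := hB.symm.trans hI
  exact_mod_cast this.symm

/-- **`‖B(u, v)‖ ≤ B(Re u, Re v) = Γ(Re u)Γ(Re v)/Γ(Re u + Re v)`** for `Re u, Re v > 0`: the modulus of
the Beta integrand `t^{u−1}(1−t)^{v−1}` on `(0, 1)` is `t^{Re u−1}(1−t)^{Re v−1}`. [folklore] -/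
theorem norm_betaIntegral_le {u v : ℂ} (hu : 0 < u.re) (hv : 0 < v.re) :
    ‖Complex.betaIntegral u v‖ ≤ Real.Gamma u.re * Real.Gamma v.re / Real.Gamma (u.re + v.re) := by
  rw [← integral_rpow_mul_one_sub_rpow hu hv, Complex.betaIntegral]
  -- integrability of the real majorant, from the convergence of `B(Re u, Re v)`
  have hconv := Complex.betaIntegral_convergent (u := (u.re : ℂ)) (v := (v.re : ℂ))
    (by simpa using hu) (by simpa using hv)
  have h1 : ∀ᵐ t : ℝ, t ≠ 1 := by
    rw [ae_iff]
    simp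
  have hnorm : ∀ t : ℝ, t ∈ Ioc (0 : ℝ) 1 → t ≠ 1 →
      ‖(t : ℂ) ^ (u - 1) * (1 - (t : ℂ)) ^ (v - 1)‖ = t ^ (u.re - 1) * (1 - t) ^ (v.re - 1) := by
    intro t ht ht1
    have ht0 : 0 < t := ht.1
    have ht1' : 0 < 1 - t := by
      rcases lt_or_eq_of_le ht.2 with h | h
      · linarith
      · exact absurd h ht1
    rw [norm_mul, Complex.norm_cpow_eq_rpow_re_of_pos ht0,
      show (1 - (t : ℂ)) = ((1 - t : ℝ) : ℂ) by push_cast; ring,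
      Complex.norm_cpow_eq_rpow_re_of_pos ht1']
    simp
  have hnorm' : ∀ t : ℝ, t ∈ Ioc (0 : ℝ) 1 → t ≠ 1 →
      ‖(t : ℂ) ^ ((u.re : ℂ) - 1) * (1 - (t : ℂ)) ^ ((v.re : ℂ) - 1)‖ =
        t ^ (u.re - 1) * (1 - t) ^ (v.re - 1) := by
    intro t ht ht1
    have ht0 : 0 < t := ht.1
    have ht1' : 0 < 1 - t := by
      rcases lt_or_eq_of_le ht.2 with h | h
      · linarith
      · exact absurd h ht1
    rw [norm_mul, Complex.norm_cpow_eq_rpow_re_of_pos ht0,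
      show (1 - (t : ℂ)) = ((1 - t : ℝ) : ℂ) by push_cast; ring,
      Complex.norm_cpow_eq_rpow_re_of_pos ht1']
    simp
  have hint : IntervalIntegrable (fun t : ℝ ↦ t ^ (u.re - 1) * (1 - t) ^ (v.re - 1)) volume 0 1 := by
    have h := hconv.norm
    rw [intervalIntegrable_iff] at h ⊢
    refine h.congr_fun_ae ?_
    rw [Filter.EventuallyEq, ae_restrict_iff' measurableSet_uIoc]
    filter_upwards [h1] with t ht1 ht
    rw [uIoc_of_le zero_le_one] at ht
    exact hnorm' t ht ht1
  refine intervalIntegral.norm_integral_le_of_norm_le zero_le_one ?_ hint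
  filter_upwards [h1] with t ht1 ht
  exact (hnorm t ht ht1).le

/-- `B(9/2, ½) = Γ(9/2)Γ(½)/Γ(5) = 105π/384`. [folklore] -/
theorem beta_nine_halves_one_half :
    Real.Gamma (9 / 2) * Real.Gamma (1 / 2) / Real.Gamma (9 / 2 + 1 / 2) = 105 * π / 384 := by
  have h5 : Real.Gamma (9 / 2 + 1 / 2) = 24 := by
    rw [show (9 / 2 + 1 / 2 : ℝ) = (4 : ℕ) + 1 by norm_num, Real.Gamma_nat_eq_factorial]
    norm_num [Nat.factorial]
  have h92 : Real.Gamma (9 / 2) = 105 / 16 * Real.sqrt π := by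
    have e1 : Real.Gamma (9 / 2) = 7 / 2 * Real.Gamma (7 / 2) := by
      rw [show (9 / 2 : ℝ) = 7 / 2 + 1 by norm_num, Real.Gamma_add_one (by norm_num)]
    have e2 : Real.Gamma (7 / 2) = 5 / 2 * Real.Gamma (5 / 2) := by
      rw [show (7 / 2 : ℝ) = 5 / 2 + 1 by norm_num, Real.Gamma_add_one (by norm_num)]
    have e3 : Real.Gamma (5 / 2) = 3 / 2 * Real.Gamma (3 / 2) := by
      rw [show (5 / 2 : ℝ) = 3 / 2 + 1 by norm_num, Real.Gamma_add_one (by norm_num)]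
    have e4 : Real.Gamma (3 / 2) = 1 / 2 * Real.Gamma (1 / 2) := by
      rw [show (3 / 2 : ℝ) = 1 / 2 + 1 by norm_num, Real.Gamma_add_one (by norm_num)]
    rw [e1, e2, e3, e4, Real.Gamma_one_half_eq]
    ring
  rw [h5, h92, Real.Gamma_one_half_eq]
  have hπ : Real.sqrt π * Real.sqrt π = π := Real.mul_self_sqrt Real.pi_pos.le
  linear_combination (105 / 16 / 24 : ℝ) * hπ

/-! ### The quotient `q(w) = ξ(w − 1)/ξ(w)` -/

/-- On the line `Re w = 1`: `ξ(w − 1) = conj ξ(w)` (functional equation `ξ(w − 1) = ξ(2 − w)` and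
`2 − w = w̄`), so `|ξ(w − 1)| = |ξ(w)|` there. [cite: LagariasSuzuki2006, Theorem 2.1 (proof)] -/
theorem riemannXi_sub_one_of_re_eq_one {w : ℂ} (hw : w.re = 1) :
    riemannXi (w - 1) = conj (riemannXi w) := by
  have h2 : w - 1 = 1 - conj w := by
    apply Complex.ext <;> simp [hw]
  rw [h2, riemannXi_one_sub, show riemannXi (conj w) = conj (riemannXi w) from riemannXi_conj_holds w]

/-- `ξ(w) = ½ w(w − 1) π^{−w/2} Γ(w/2) ζ(w)` for `Re w > 1` (all factors genuine there). [folklore] -/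
theorem riemannXi_eq_of_one_lt_re {w : ℂ} (hw : 1 < w.re) :
    riemannXi w = w * (w - 1) / 2 * (π : ℂ) ^ (-w / 2) * Complex.Gamma (w / 2) * riemannZeta w := by
  have hw1 : w ≠ 1 := fun h ↦ by rw [h, one_re] at hw; exact lt_irrefl _ hw
  rw [riemannXi_eq_mul_of_re_pos (by linarith), LFunctions.riemannZeta₁_eq_mul hw1, Gammaℝ_def]
  ring

/-- **The right edge `Re w = 10`: `|ξ(w − 1)| ≤ 0.87 |ξ(w)|`.** Here
`ξ(w−1)/ξ(w) = ((w−2)/w) · B((w−1)/2, ½) · ζ(w−1)/ζ(w)` with `|B| ≤ B(9/2, ½) = 105π/384 < 0.86`,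
`|ζ(w − 1) | ≤ 1 + 2^{−7}(π²/6 − 1)`, `|ζ(w)| ≥ 1 − 2^{−8}(π²/6 − 1)`. [folklore] -/
theorem norm_riemannXi_sub_one_le_of_re_eq_ten {w : ℂ} (hw : w.re = 10) :
    ‖riemannXi (w - 1)‖ ≤ 0.87 * ‖riemannXi w‖ := by
  have hπ3 := Real.pi_gt_three
  have hπ4 := Real.pi_lt_d4
  -- the factors
  set u : ℂ := (w - 1) / 2 with hu
  have hu_re : u.re = 9 / 2 := by rw [hu]; simp [hw]; norm_num
  have hu0 : 0 < u.re := by rw [hu_re]; norm_num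
  have hhalf : (0 : ℝ) < (1 / 2 : ℂ).re := by norm_num
  have hw0 : w ≠ 0 := fun h ↦ by rw [h, zero_re] at hw; norm_num at hw
  have hw1 : w - 1 ≠ 0 := fun h ↦ by
    have := congrArg re h; simp [hw] at this; norm_num at this
  have hζw : riemannZeta w ≠ 0 := riemannZeta_ne_zero_of_one_lt_re (by rw [hw]; norm_num)
  have hΓ : Complex.Gamma (u + 1 / 2) ≠ 0 :=
    Complex.Gamma_ne_zero_of_re_pos (by simp [hu_re]; norm_num)
  have hΓu : Complex.Gamma u ≠ 0 := Complex.Gamma_ne_zero_of_re_pos hu0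
  -- `Γ(u) √π = Γ(u + ½) B(u, ½)`
  have hbeta := Complex.Gamma_mul_Gamma_eq_betaIntegral hu0 hhalf
  have hsqrt : Complex.Gamma (1 / 2 : ℂ) = (Real.sqrt π : ℂ) := by
    rw [show (1 / 2 : ℂ) = ((1 / 2 : ℝ) : ℂ) by push_cast; ring, Complex.Gamma_ofReal,
      Real.Gamma_one_half_eq]
  -- `ξ(w − 1)` and `ξ(w)` as products
  have hξ1 : riemannXi (w - 1) = (w - 1) * (w - 2) / 2 * (π : ℂ) ^ (-(w - 1) / 2) *
      Complex.Gamma u * riemannZeta (w - 1) := by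
    rw [riemannXi_eq_of_one_lt_re (by simp [hw]; norm_num)]
    rw [hu]; ring_nf
  have hξ0 : riemannXi w = w * (w - 1) / 2 * (π : ℂ) ^ (-w / 2) *
      Complex.Gamma (u + 1 / 2) * riemannZeta w := by
    rw [riemannXi_eq_of_one_lt_re (by rw [hw]; norm_num)]
    rw [hu]; ring_nf
  -- norms of the elementary factors
  have hw2_le : ‖w - 2‖ ≤ ‖w‖ := by
    have e1 : ‖w - 2‖ ^ 2 = (w.re - 2) ^ 2 + w.im ^ 2 := by
      rw [Complex.sq_norm, Complex.normSq_apply]; simp; ring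
    have e2 : ‖w‖ ^ 2 = w.re ^ 2 + w.im ^ 2 := by
      rw [Complex.sq_norm, Complex.normSq_apply]; ring
    have : ‖w - 2‖ ^ 2 ≤ ‖w‖ ^ 2 := by rw [e1, e2, hw]; norm_num
    exact le_of_sq_le_sq this (norm_nonneg _)
  -- `|B(u, ½)| ≤ 105π/384`
  have hB : ‖Complex.betaIntegral u (1 / 2)‖ ≤ 105 * π / 384 := by
    have h := norm_betaIntegral_le hu0 hhalf
    rw [hu_re, show (1 / 2 : ℂ).re = 1 / 2 by norm_num, beta_nine_halves_one_half] at h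
    exact h
  -- `ζ` on the two lines
  have hc : π ^ 2 / 6 - 1 ≤ 0.66 := by nlinarith
  have hζ9 : ‖riemannZeta (w - 1)‖ ≤ 1.006 := by
    have h := norm_riemannZeta_sub_one_le_of_two_le_re (s := w - 1) (by simp [hw]; norm_num)
    have e : (2 : ℝ) ^ (2 - (w - 1).re) = 1 / 128 := by
      rw [show (w - 1).re = 9 by simp [hw]; norm_num, show (2 : ℝ) - 9 = -7 by norm_num,
        Real.rpow_neg (by norm_num), show (7 : ℝ) = (7 : ℕ) by norm_num, Real.rpow_natCast]
      norm_num
    rw [e] at h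
    have := norm_le_norm_add_norm_sub' (riemannZeta (w - 1)) 1
    rw [norm_one] at this
    have h' : ‖riemannZeta (w - 1) - 1‖ ≤ 0.006 := h.trans (by nlinarith)
    linarith
  have hζ10 : 0.997 ≤ ‖riemannZeta w‖ := by
    have h := norm_riemannZeta_sub_one_le_of_two_le_re (s := w) (by rw [hw]; norm_num)
    have e : (2 : ℝ) ^ (2 - w.re) = 1 / 256 := by
      rw [hw, show (2 : ℝ) - 10 = -8 by norm_num, Real.rpow_neg (by norm_num),
        show (8 : ℝ) = (8 : ℕ) by norm_num, Real.rpow_natCast]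
      norm_num
    rw [e] at h
    have := norm_sub_norm_le 1 (riemannZeta w)
    rw [norm_one] at this
    have h' : ‖1 - riemannZeta w‖ ≤ 0.003 := by rw [norm_sub_rev]; exact h.trans (by nlinarith)
    linarith
  -- assemble: `ξ(w−1) · [w Γ(u+½) ζ(w) √π] = ξ(w) · [(w−2) Γ(u) √π ζ(w−1)]`-type comparison
  have key : riemannXi (w - 1) * (w * Complex.Gamma (u + 1 / 2) * riemannZeta w) =
      riemannXi w * ((w - 2) * (Real.sqrt π : ℂ)⁻¹ * (π : ℂ) ^ ((1 : ℂ) / 2) *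
        (Complex.Gamma (u + 1 / 2) * Complex.betaIntegral u (1 / 2)) * riemannZeta (w - 1)) := by
    rw [← hbeta, hsqrt, hξ1, hξ0]
    have hsq : (Real.sqrt π : ℂ) ≠ 0 := by
      exact_mod_cast (Real.sqrt_pos.2 Real.pi_pos).ne'
    have hπc : (π : ℂ) ≠ 0 := by exact_mod_cast Real.pi_pos.ne'
    have e : (π : ℂ) ^ (-(w - 1) / 2) = (π : ℂ) ^ (-w / 2) * (π : ℂ) ^ ((1 : ℂ) / 2) := by
      rw [← Complex.cpow_add _ _ hπc]; congr 1; ring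
    rw [e]
    field_simp
  -- take norms
  have hnorm : ‖riemannXi (w - 1)‖ * ‖w * Complex.Gamma (u + 1 / 2) * riemannZeta w‖ =
      ‖riemannXi w‖ * ‖(w - 2) * (Real.sqrt π : ℂ)⁻¹ * (π : ℂ) ^ ((1 : ℂ) / 2) *
        (Complex.Gamma (u + 1 / 2) * Complex.betaIntegral u (1 / 2)) * riemannZeta (w - 1)‖ := by
    rw [← norm_mul, ← norm_mul, key]
  have hπhalf : ‖(π : ℂ) ^ ((1 : ℂ) / 2)‖ = Real.sqrt π := by
    rw [show ((1 : ℂ) / 2) = ((1 / 2 : ℝ) : ℂ) by push_cast; ring,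
      Complex.norm_cpow_eq_rpow_re_of_pos Real.pi_pos, Complex.ofReal_re, Real.sqrt_eq_rpow]
  have hsq0 : 0 < Real.sqrt π := Real.sqrt_pos.2 Real.pi_pos
  have hX : ‖w * Complex.Gamma (u + 1 / 2) * riemannZeta w‖ =
      ‖w‖ * ‖Complex.Gamma (u + 1 / 2)‖ * ‖riemannZeta w‖ := by
    rw [norm_mul, norm_mul]
  have hY : ‖(w - 2) * (Real.sqrt π : ℂ)⁻¹ * (π : ℂ) ^ ((1 : ℂ) / 2) *
        (Complex.Gamma (u + 1 / 2) * Complex.betaIntegral u (1 / 2)) * riemannZeta (w - 1)‖ =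
      ‖w - 2‖ * (‖Complex.Gamma (u + 1 / 2)‖ * ‖Complex.betaIntegral u (1 / 2)‖) *
        ‖riemannZeta (w - 1)‖ := by
    rw [norm_mul, norm_mul, norm_mul, norm_mul, norm_mul, norm_inv, hπhalf, Complex.norm_real,
      Real.norm_of_nonneg hsq0.le, mul_assoc (‖w - 2‖) ((Real.sqrt π)⁻¹), inv_mul_cancel₀ hsq0.ne',
      mul_one]
  rw [hX, hY] at hnorm
  -- positivity of the common factors
  have hpos : 0 < ‖w‖ * ‖Complex.Gamma (u + 1 / 2)‖ * ‖riemannZeta w‖ := by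
    have h1 : 0 < ‖w‖ := norm_pos_iff.2 hw0
    have h2 : 0 < ‖Complex.Gamma (u + 1 / 2)‖ := norm_pos_iff.2 hΓ
    have h3 : 0 < ‖riemannZeta w‖ := norm_pos_iff.2 hζw
    positivity
  -- the right-hand bracket is at most `0.87 · ‖w‖ ‖Γ(u+½)‖ ‖ζ w‖`
  have hbr : ‖w - 2‖ * (‖Complex.Gamma (u + 1 / 2)‖ * ‖Complex.betaIntegral u (1 / 2)‖) *
      ‖riemannZeta (w - 1)‖ ≤ 0.87 * (‖w‖ * ‖Complex.Gamma (u + 1 / 2)‖ * ‖riemannZeta w‖) := by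
    have hG0 : 0 ≤ ‖Complex.Gamma (u + 1 / 2)‖ := norm_nonneg _
    have hB0 : 0 ≤ ‖Complex.betaIntegral u (1 / 2)‖ := norm_nonneg _
    have hw0' : 0 ≤ ‖w - 2‖ := norm_nonneg _
    have hz0 : 0 ≤ ‖riemannZeta (w - 1)‖ := norm_nonneg _
    have hB' : ‖Complex.betaIntegral u (1 / 2)‖ ≤ 0.86 := hB.trans (by nlinarith)
    calc ‖w - 2‖ * (‖Complex.Gamma (u + 1 / 2)‖ * ‖Complex.betaIntegral u (1 / 2)‖) *
          ‖riemannZeta (w - 1)‖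
        ≤ ‖w‖ * (‖Complex.Gamma (u + 1 / 2)‖ * 0.86) * 1.006 := by
          gcongr
      _ = (0.86 * 1.006) * (‖w‖ * ‖Complex.Gamma (u + 1 / 2)‖) := by ring
      _ ≤ (0.87 * 0.997) * (‖w‖ * ‖Complex.Gamma (u + 1 / 2)‖) := by
          apply mul_le_mul_of_nonneg_right (by norm_num) (by positivity)
      _ = 0.87 * (‖w‖ * ‖Complex.Gamma (u + 1 / 2)‖ * 0.997) := by ring
      _ ≤ 0.87 * (‖w‖ * ‖Complex.Gamma (u + 1 / 2)‖ * ‖riemannZeta w‖) := by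
          gcongr
  have h := hnorm.le.trans (mul_le_mul_of_nonneg_left hbr (norm_nonneg _))
  exact le_of_mul_le_mul_right (h.trans_eq (by ring)) hpos

/-- Growth inside the strip: there are `C, R` with `‖ξ(w − 1)/ξ(w)‖ ≤ exp(C |Im w|²)` for
`1 ≤ Re w ≤ 10`, `|Im w| ≥ R` (boundedness of `Λ₀` on strips, the Gaussian-type bound for `1/Γ` on
strips, and `1/|ζ| ≤ K log⁷|t|` resp. `|ζ| ≥ 0.34`). [folklore] -/
theorem exists_norm_riemannXi_div_le_exp_sq :
    ∃ C R : ℝ, 0 ≤ C ∧ 4 ≤ R ∧ ∀ w : ℂ, 1 ≤ w.re → w.re ≤ 10 → R ≤ |w.im| →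
      ‖riemannXi (w - 1) / riemannXi w‖ ≤ Real.exp (C * |w.im| ^ 2) := by
  -- constants
  obtain ⟨M, hM0, hM⟩ := NumberField.weakFEPair_exists_norm_Λ₀_le (HurwitzZeta.hurwitzEvenFEPair 0) 0 5
  obtain ⟨A, c, hA0, hc0, hAc⟩ := NumberField.exists_norm_inv_Gamma_le_of_abs_re_le (S := 5) (by norm_num)
  set K : ℝ := 1134 * 16 * 336 ^ 4 with hK
  have hK1 : 1 ≤ K := by rw [hK]; norm_num
  -- the bound: we use `log|t| ≤ |t|`, `|t|^k ≤ exp(k|t|) ≤ exp(k |t|²)` freely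
  refine ⟨M + A + 26 * c + K + 1176, 4, by positivity, le_rfl, ?_⟩
  intro w h1 h10 hR
  set t : ℝ := w.im with ht
  have ht4 : 4 ≤ |t| := hR
  have ht1 : 1 ≤ |t| := by linarith
  have hw0 : w ≠ 0 := fun h ↦ by rw [h, zero_re] at h1; norm_num at h1
  have hw1 : w ≠ 1 := fun h ↦ by rw [h, one_im] at ht; rw [ht] at ht4; norm_num at ht4
  have hw_1 : w - 1 ≠ 0 := sub_ne_zero.2 hw1
  have hξ : riemannXi w ≠ 0 := riemannXi_ne_zero_of_one_le_re h1
  -- (1) `‖ξ(w − 1)‖ ≤ 1/2 + ‖(w−1)(w−2)‖ (M + 2) / 2`, from `ξ = ½ + s(s−1)Λ₀(s)/2`,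
  --     `Λ₀ = 2·completedRiemannZeta₀`, i.e. `riemannXi s = 1/2 + s(s-1)/2 · completedRiemannZeta₀ s`
  --     and `completedRiemannZeta₀ s = Λ₀^H(s/2)/2` with `‖Λ₀^H‖ ≤ M` on `0 ≤ Re ≤ 5`.
  have hΛ₀ : ‖completedRiemannZeta₀ (w - 1)‖ ≤ M / 2 := by
    have e : completedRiemannZeta₀ (w - 1) = (HurwitzZeta.hurwitzEvenFEPair 0).Λ₀ ((w - 1) / 2) / 2 := rfl
    rw [e, norm_div, Complex.norm_two]
    have := hM ((w - 1) / 2) (by simp; linarith) (by simp; linarith)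
    linarith
  have hnum : ‖riemannXi (w - 1)‖ ≤ (1 + ‖w‖) ^ 2 * (M + 1) := by
    rw [riemannXi]
    set n : ℝ := ‖w‖ with hn
    have hn0 : 0 ≤ n := norm_nonneg w
    have hn1 : ‖w - 1‖ ≤ 1 + n := by
      calc ‖w - 1‖ ≤ ‖w‖ + ‖(1 : ℂ)‖ := norm_sub_le _ _
        _ = 1 + n := by rw [norm_one, hn]; ring
    have hn2 : ‖w - 1 - 1‖ ≤ 2 + n := by
      calc ‖w - 1 - 1‖ ≤ ‖w - 1‖ + ‖(1 : ℂ)‖ := norm_sub_le _ _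
        _ ≤ 2 + n := by rw [norm_one]; linarith
    have hprod : ‖w - 1‖ * ‖w - 1 - 1‖ * ‖completedRiemannZeta₀ (w - 1)‖ ≤
        (1 + n) * (2 + n) * (M / 2) :=
      mul_le_mul (mul_le_mul hn1 hn2 (norm_nonneg _) (by positivity)) hΛ₀ (norm_nonneg _)
        (by positivity)
    have h2n : (1 + n) * (2 + n) * (M / 2) ≤ (1 + n) * (2 * (1 + n)) * (M / 2) := by
      gcongr; linarith
    have hsq : 1 * 1 ≤ (1 + n) ^ 2 * (M / 2 + 1) :=
      mul_le_mul (by nlinarith) (by linarith) zero_le_one (by positivity)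
    calc ‖1 / 2 + (w - 1) * (w - 1 - 1) / 2 * completedRiemannZeta₀ (w - 1)‖
        ≤ ‖(1 / 2 : ℂ)‖ + ‖(w - 1) * (w - 1 - 1) / 2 * completedRiemannZeta₀ (w - 1)‖ := norm_add_le _ _
      _ = 1 / 2 + ‖w - 1‖ * ‖w - 1 - 1‖ * ‖completedRiemannZeta₀ (w - 1)‖ / 2 := by
          simp only [norm_mul, norm_div, Complex.norm_two]
          norm_num
          ring
      _ ≤ 1 / 2 + (1 + n) * (2 * (1 + n)) * (M / 2) / 2 := by linarith
      _ ≤ (1 + n) ^ 2 * (M + 1) := by nlinarith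
  -- (2) `‖ξ(w)‖⁻¹ ≤ 2 π⁵ ‖Γ(w/2)⁻¹‖ ‖ζ(w)⁻¹‖` (`|w(w−1)| ≥ 1`)
  have hξw : riemannXi w = w * (w - 1) / 2 * (π : ℂ) ^ (-w / 2) * Complex.Gamma (w / 2) *
      riemannZeta w := by
    rcases eq_or_lt_of_le h1 with h | h
    · -- `Re w = 1`: still `w ≠ 0, 1`
      rw [riemannXi_eq_mul_of_re_pos (by linarith), LFunctions.riemannZeta₁_eq_mul hw1, Gammaℝ_def]
      ring
    · exact riemannXi_eq_of_one_lt_re h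
  have hζinv : ‖riemannZeta w‖⁻¹ ≤ K * |t| ^ 7 := by
    rcases le_or_gt w.re 2 with h2 | h2
    · have hlog1 : 1 < Real.log |t| := by
        have := Real.log_le_log (by norm_num) ht4
        have h4 : (1 : ℝ) < Real.log 4 := by
          have := Real.log_two_gt_d9
          rw [show (4 : ℝ) = 2 ^ 2 by norm_num, Real.log_pow]; push_cast; linarith
        linarith
      have hlog0 : 0 < Real.log |t| := by linarith
      have hσ : 1 - 1 / (2 * K * Real.log |t| ^ 9) ≤ w.re := by
        have : 0 < 1 / (2 * K * Real.log |t| ^ 9) := by positivity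
        linarith
      have h := ZetaOneLine.norm_riemannZeta_ge_inv_log_pow_seven (s := w) ht4 (by rw [← hK]; exact hσ) h2
      rw [← hK] at h
      have hζ0 : 0 < ‖riemannZeta w‖ := norm_pos_iff.2 (riemannZeta_ne_zero_of_one_le_re h1)
      rw [inv_le_comm₀ hζ0 (by positivity)]
      refine le_trans ?_ h
      have hlt : Real.log |t| ≤ |t| := (Real.log_le_sub_one_of_pos (by linarith)).trans (by linarith)
      have hl7 : Real.log |t| ^ 7 ≤ |t| ^ 7 := by gcongr
      rw [div_eq_mul_inv]
      have h168 : (K * |t| ^ 7)⁻¹ ≤ (K * Real.log |t| ^ 7)⁻¹ := by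
        rw [inv_le_inv₀ (by positivity) (by positivity)]; gcongr
      calc (K * |t| ^ 7)⁻¹ = 1 * (K * |t| ^ 7)⁻¹ := (one_mul _).symm
        _ ≤ 168 * (K * Real.log |t| ^ 7)⁻¹ := by gcongr; norm_num
    · have h := norm_riemannZeta_sub_one_le_of_two_le_re (s := w) h2.le
      have hp : (2 : ℝ) ^ (2 - w.re) ≤ 1 := Real.rpow_le_one_of_one_le_of_nonpos (by norm_num) (by linarith)
      have hc' : π ^ 2 / 6 - 1 ≤ 0.66 := by nlinarith [Real.pi_lt_d2, Real.pi_gt_three]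
      have hc0 : 0 ≤ π ^ 2 / 6 - 1 := by nlinarith [Real.pi_gt_three]
      have h' : ‖riemannZeta w - 1‖ ≤ 0.66 := h.trans (by nlinarith)
      have hge : 0.34 ≤ ‖riemannZeta w‖ := by
        have := norm_sub_norm_le 1 (riemannZeta w)
        rw [norm_one, norm_sub_rev] at this
        linarith
      calc ‖riemannZeta w‖⁻¹ ≤ 0.34⁻¹ := by
            rw [inv_le_inv₀ (by linarith) (by norm_num)]; exact hge
        _ ≤ K * |t| ^ 7 := by
            have : (1 : ℝ) ≤ |t| ^ 7 := one_le_pow₀ ht1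
            nlinarith
  have hΓinv : ‖Complex.Gamma (w / 2)‖⁻¹ ≤ A * Real.exp (c * 26 * |t| ^ 2) := by
    have h := hAc (w / 2) (by rw [abs_le]; constructor <;> · simp; linarith)
    rw [norm_inv] at h
    refine h.trans (mul_le_mul_of_nonneg_left (Real.exp_le_exp.2 ?_) hA0)
    have hn : ‖w / 2‖ ^ 2 ≤ 26 * |t| ^ 2 := by
      rw [norm_div, Complex.norm_two, div_pow, Complex.sq_norm, Complex.normSq_apply]
      have : w.re * w.re ≤ 100 := by nlinarith
      have ht2 : t ^ 2 = |t| ^ 2 := (sq_abs t).symm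
      nlinarith [sq_nonneg t, sq_abs t]
    nlinarith
  have hπpow : ‖(π : ℂ) ^ (-w / 2)‖⁻¹ ≤ π ^ 5 := by
    rw [Complex.norm_cpow_eq_rpow_re_of_pos Real.pi_pos, ← Real.rpow_neg Real.pi_pos.le]
    have : -(-w / 2).re ≤ 5 := by simp; linarith
    calc π ^ (-(-w / 2).re) ≤ π ^ (5 : ℝ) := Real.rpow_le_rpow_of_exponent_le (by linarith [Real.pi_gt_three]) this
      _ = π ^ 5 := by norm_num
  have hww : 1 ≤ ‖w * (w - 1) / 2‖ := by
    rw [norm_div, Complex.norm_two, norm_mul]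
    have h1' : |t| ≤ ‖w‖ := by rw [ht]; exact Complex.abs_im_le_norm w
    have h2' : |t| ≤ ‖w - 1‖ := by
      have := Complex.abs_im_le_norm (w - 1)
      simpa [ht] using this
    nlinarith [norm_nonneg w, norm_nonneg (w - 1)]
  -- (3) combine
  have hq : ‖riemannXi (w - 1) / riemannXi w‖ ≤
      (1 + ‖w‖) ^ 2 * (M + 1) * (π ^ 5 * (A * Real.exp (c * 26 * |t| ^ 2)) * (K * |t| ^ 7)) := by
    rw [norm_div, div_eq_mul_inv]
    refine mul_le_mul hnum ?_ (by positivity) (by positivity)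
    rw [hξw, norm_mul, norm_mul, norm_mul, mul_inv, mul_inv, mul_inv]
    have e1 : ‖w * (w - 1) / 2‖⁻¹ ≤ 1 := inv_le_one_of_one_le₀ hww
    calc ‖w * (w - 1) / 2‖⁻¹ * ‖(π : ℂ) ^ (-w / 2)‖⁻¹ * ‖Complex.Gamma (w / 2)‖⁻¹ *
          ‖riemannZeta w‖⁻¹
        ≤ 1 * π ^ 5 * (A * Real.exp (c * 26 * |t| ^ 2)) * (K * |t| ^ 7) := by
          gcongr
      _ = π ^ 5 * (A * Real.exp (c * 26 * |t| ^ 2)) * (K * |t| ^ 7) := by ring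
  refine hq.trans ?_
  -- crude numerics: with `L = |t|² ≥ 1`, every factor is `≤ exp(const · L)`
  set L : ℝ := |t| ^ 2 with hL
  have hL1 : 1 ≤ L := by rw [hL]; nlinarith
  have htL : |t| ≤ L := by rw [hL]; nlinarith
  have aux : ∀ a : ℝ, 0 ≤ a → a ≤ Real.exp (a * L) := fun a ha ↦ by
    have h1 : a ≤ a * L := by nlinarith
    have h2 : a * L + 1 ≤ Real.exp (a * L) := Real.add_one_le_exp _
    linarith
  have hwn : ‖w‖ ≤ 10 + |t| := by
    calc ‖w‖ ≤ |w.re| + |w.im| := Complex.norm_le_abs_re_add_abs_im w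
      _ ≤ 10 + |t| := by rw [abs_of_pos (by linarith : 0 < w.re)]; linarith
  have f1 : (1 + ‖w‖) ^ 2 ≤ Real.exp (144 * L) := by
    have h' : (1 + ‖w‖) ^ 2 ≤ 144 * L := by
      have : 1 + ‖w‖ ≤ 12 * |t| := by linarith
      calc (1 + ‖w‖) ^ 2 ≤ (12 * |t|) ^ 2 := pow_le_pow_left₀ (by positivity) this 2
        _ = 144 * L := by rw [hL]; ring
    exact h'.trans ((le_add_of_nonneg_right zero_le_one).trans
      (by linarith [Real.add_one_le_exp (144 * L)]))
  have f2 : M + 1 ≤ Real.exp ((M + 1) * L) := aux _ (by positivity)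
  have f3 : π ^ 5 ≤ Real.exp (1024 * L) := by
    have hp : π ^ 5 ≤ (4 : ℝ) ^ 5 := by gcongr; linarith [Real.pi_lt_d2]
    exact hp.trans (by norm_num; exact aux 1024 (by norm_num))
  have f4 : A ≤ Real.exp (A * L) := aux _ hA0
  have f5 : Real.exp (c * 26 * |t| ^ 2) = Real.exp (26 * c * L) := by rw [hL]; ring_nf
  have f6 : K ≤ Real.exp (K * L) := aux _ (by positivity)
  have f7 : |t| ^ 7 ≤ Real.exp (7 * L) := by
    have h1' : |t| ≤ Real.exp |t| := by linarith [Real.add_one_le_exp |t|]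
    have e7 : Real.exp (7 * |t|) = Real.exp |t| ^ 7 := by
      rw [← Real.exp_nat_mul]; norm_num
    have h77 : 7 * |t| ≤ 7 * L := by linarith
    calc |t| ^ 7 ≤ (Real.exp |t|) ^ 7 := by gcongr
      _ = Real.exp (7 * |t|) := e7.symm
      _ ≤ Real.exp (7 * L) := Real.exp_le_exp.2 h77
  calc (1 + ‖w‖) ^ 2 * (M + 1) * (π ^ 5 * (A * Real.exp (c * 26 * |t| ^ 2)) * (K * |t| ^ 7))
      ≤ Real.exp (144 * L) * Real.exp ((M + 1) * L) * (Real.exp (1024 * L) *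
          (Real.exp (A * L) * Real.exp (26 * c * L)) * (Real.exp (K * L) * Real.exp (7 * L))) := by
        rw [f5]; gcongr
    _ = Real.exp ((M + A + 26 * c + K + 1176) * L) := by
        simp only [← Real.exp_add]; congr 1; ring

/-- **Lagarias–Suzuki's inequality `|ξ(w − 1)| ≤ |ξ(w)|` on `1 ≤ Re w ≤ 10`** (their Theorem 2.1
applied to `F(s) = ξ(2s − ½)`, `a = c = ¼`, gives the strict inequality for `Re w > 1`; the weak
form on the closed strip is what is proved and used here). Proof by the Phragmén–Lindelöf principle
for `ξ(w − 1)/ξ(w)` on the strip, see the module docstring.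
[cite: LagariasSuzuki2006, Theorem 2.1 and §2 (proof of Theorem 1.2)] -/
theorem norm_riemannXi_sub_one_le {w : ℂ} (h1 : 1 ≤ w.re) (h10 : w.re ≤ 10) :
    ‖riemannXi (w - 1)‖ ≤ ‖riemannXi w‖ := by
  set q : ℂ → ℂ := fun z ↦ riemannXi (z - 1) / riemannXi z with hq
  have hξ : ∀ z : ℂ, 1 ≤ z.re → riemannXi z ≠ 0 := fun z hz ↦ riemannXi_ne_zero_of_one_le_re hz
  suffices hmain : ‖q w‖ ≤ 1 by
    have := hmain
    rw [hq] at this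
    simp only [norm_div] at this
    rwa [div_le_one (norm_pos_iff.2 (hξ w h1))] at this
  -- differentiability on the closed strip
  have hdiff : DifferentiableOn ℂ q (re ⁻¹' Icc 1 10) := by
    intro z hz
    have hz1 : 1 ≤ z.re := hz.1
    apply DifferentiableAt.differentiableWithinAt
    exact ((differentiable_riemannXi.comp (differentiable_id.sub_const 1)) z).div
      (differentiable_riemannXi z) (hξ z hz1)
  have hdcl : DiffContOnCl ℂ q (re ⁻¹' Ioo 1 10) := by
    refine (hdiff.mono ?_).diffContOnCl
    refine (continuous_re.closure_preimage_subset _).trans ?_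
    rw [closure_Ioo (by norm_num : (1 : ℝ) ≠ 10)]
  -- growth
  obtain ⟨C, R, hC0, hR4, hgrowth⟩ := exists_norm_riemannXi_div_le_exp_sq
  have hB : ∃ c < π / (10 - 1), ∃ B,
      q =O[comap (_root_.abs ∘ im) atTop ⊓ 𝓟 (re ⁻¹' Ioo 1 10)]
        fun z ↦ Real.exp (B * Real.exp (c * |z.im|)) := by
    refine ⟨3 / 10, ?_, C * (200 / 9), ?_⟩
    · have := Real.pi_gt_three
      rw [lt_div_iff₀ (by norm_num)]; linarith
    refine IsBigO.of_bound 1 ?_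
    rw [eventually_inf_principal]
    have hev : ∀ᶠ z : ℂ in comap (_root_.abs ∘ im) atTop, R ≤ |z.im| := by
      refine (eventually_comap.2 ?_)
      filter_upwards [eventually_ge_atTop R] with b hb z hz
      rw [show |z.im| = b from hz]; exact hb
    filter_upwards [hev] with z hz hzmem
    rw [one_mul, Real.norm_eq_abs, abs_of_pos (Real.exp_pos _)]
    refine (hgrowth z hzmem.1.le hzmem.2.le hz).trans (Real.exp_le_exp.2 ?_)
    -- `C |t|² ≤ C (200/9) exp(3|t|/10)` since `x² ≤ (200/9) e^{3x/10}` (`e^y ≥ 1 + y + y²/2`)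
    have hx : |z.im| ^ 2 ≤ 200 / 9 * Real.exp (3 / 10 * |z.im|) := by
      have h := Real.quadratic_le_exp_of_nonneg (show 0 ≤ 3 / 10 * |z.im| by positivity)
      nlinarith [abs_nonneg z.im]
    calc C * |z.im| ^ 2 ≤ C * (200 / 9 * Real.exp (3 / 10 * |z.im|)) :=
          mul_le_mul_of_nonneg_left hx hC0
      _ = C * (200 / 9) * Real.exp (3 / 10 * |z.im|) := by ring
  -- the two edges
  have hle_a : ∀ z : ℂ, z.re = 1 → ‖q z‖ ≤ 1 := by
    intro z hz
    rw [hq]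
    simp only
    rw [riemannXi_sub_one_of_re_eq_one hz, norm_div, Complex.norm_conj,
      div_self (norm_ne_zero_iff.2 (hξ z hz.ge))]
  have hle_b : ∀ z : ℂ, z.re = 10 → ‖q z‖ ≤ 1 := by
    intro z hz
    rw [hq]
    simp only
    rw [norm_div, div_le_one (norm_pos_iff.2 (hξ z (by rw [hz]; norm_num)))]
    exact (norm_riemannXi_sub_one_le_of_re_eq_ten hz).trans
      (mul_le_of_le_one_left (norm_nonneg _) (by norm_num))
  exact PhragmenLindelof.vertical_strip hdcl hB hle_a hle_b h1 h10

/-- **The shift inequality for Mathlib's completed zeta function**: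
`‖(s − 1) Λ(2s − 1)‖ ≤ ‖s Λ(2s)‖` for `½ < Re s ≤ 5`, `s ≠ 1` (`Λ = completedRiemannZeta`;
`ξ(2s) = s(2s−1)Λ(2s)`, `ξ(2s−1) = (2s−1)(s−1)Λ(2s−1)`). Equivalently `|f(1 − s)| ≤ k^{1−2σ}|s/(s−1)||f(s)|`
for `f(s) = k^s Λ(2s)`, the comparison of the two main terms of the Epstein zeta function.
[cite: LagariasSuzuki2006, Theorem 2.1 and §3 (400)] -/
theorem norm_completedRiemannZeta_shift_le {s : ℂ} (hs : 1 / 2 < s.re) (hs5 : s.re ≤ 5)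
    (hs1 : s ≠ 1) :
    ‖(s - 1) * completedRiemannZeta (2 * s - 1)‖ ≤ ‖s * completedRiemannZeta (2 * s)‖ := by
  have h2s0 : 2 * s ≠ 0 := by
    intro h; have := congrArg re h; simp at this; linarith
  have h2s1 : 2 * s ≠ 1 := by
    intro h; have := congrArg re h; simp at this; linarith
  have h2s10 : 2 * s - 1 ≠ 0 := sub_ne_zero.2 h2s1
  have h2s11 : 2 * s - 1 ≠ 1 := by
    intro h
    apply hs1
    have : 2 * s = 2 := by linear_combination h
    have := mul_left_cancel₀ (two_ne_zero (α := ℂ)) (this.trans (mul_one 2).symm)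
    exact this
  have hξ2 : riemannXi (2 * s) = 2 * s * (2 * s - 1) / 2 * completedRiemannZeta (2 * s) :=
    riemannXi_eq_mul_completedRiemannZeta h2s0 h2s1
  have hξ1 : riemannXi (2 * s - 1) =
      (2 * s - 1) * (2 * s - 1 - 1) / 2 * completedRiemannZeta (2 * s - 1) :=
    riemannXi_eq_mul_completedRiemannZeta h2s10 h2s11
  have h := norm_riemannXi_sub_one_le (w := 2 * s) (by simp; linarith) (by simp; linarith)
  rw [hξ1, hξ2] at h
  have e1 : (2 * s - 1) * (2 * s - 1 - 1) / 2 * completedRiemannZeta (2 * s - 1) =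
      (2 * s - 1) * ((s - 1) * completedRiemannZeta (2 * s - 1)) := by ring
  have e2 : 2 * s * (2 * s - 1) / 2 * completedRiemannZeta (2 * s) =
      (2 * s - 1) * (s * completedRiemannZeta (2 * s)) := by ring
  rw [e1, e2] at h
  simp only [norm_mul] at h ⊢
  exact le_of_mul_le_mul_left h (norm_pos_iff.2 h2s10)

end Literature.NumberTheory.LFunctions
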